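import Summits.MatrixMultiplication.MatrixMultiplication.Theorems.LevelGradedCohnUmansGradedDesignFamilyStubSubfieldCellModPDuals
import Summits.MatrixMultiplication.MatrixMultiplication.Theorems.LevelGradedCohnUmansGradedDesignFamilyStubSubfieldCellSixteenWitnessC
import Summits.MatrixMultiplication.MatrixMultiplication.Theorems.LevelGradedCohnUmansGradedDesignFamilyStubSubfieldCellSixteenDualsE0
import Summits.MatrixMultiplication.MatrixMultiplication.Theorems.LevelGradedCohnUmansGradedDesignFamilyStubSubfieldCellSixteenDualsE1
import Summits.MatrixMultiplication.MatrixMultiplication.Theorems.LevelGradedCohnUmansGradedDesignFamilyStubSubfieldCellSixteenDualsE2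
import Summits.MatrixMultiplication.MatrixMultiplication.Theorems.LevelGradedCohnUmansGradedDesignFamilyStubSubfieldCellSixteenDualsE3
import Summits.MatrixMultiplication.MatrixMultiplication.Theorems.LevelGradedCohnUmansGradedDesignFamilyStubSubfieldCellSixteenDualsE4

/-!
# A TRUE finite instance of the subfield-cell clause of `stub_subfieldCell` at `|K| = 16`: `(|Y|, |Z|) = (1, 50)`

Route `LevelGradedCohnUmans`, crux `GradedDesignFamily` (stmt-MatrixMultiplication-7610), registered line
`Cruxes/GradedDesignFamily/Lines/quadratic_extension_level_one_cell.lean`, stub S3 `stub_subfieldCell` (the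
"subfield cell" `GL₂(𝔽_{q²}) ⊃ SL₂(𝔽_q)`), here `q = 4`.

HONEST FRAMING.  The stub is ASYMPTOTIC and this file decides nothing about it.  It belongs to a compiler-checked
TRUE finite instance of the stub's INNER CLAUSE — an injective `φ : SL₂(k) →* GL₂(K)` with `|K| = |k|²` and finite
`Y, Z ⊆ GL₂(K)` such that every `z₀ ∈ Z` has a frame function `F(g) = ∑_u cf u (g u)` with
`F(φ(a)·y·y'⁻¹·z) = [a = 1][y = y'][z = z₀]` — with `|K| = 16`, `|Y| = 1`, `|Z| = 50` (volume
`|SL₂(𝔽₄)|·|Y|·|Z| = 3000`, min(|Y|,|Z|) = 1) — the ROW-ONE design `Y = {1}`,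
`|Z| = 50`: `|Y| + |Z| = 51` ATTAINS the cell's exact counting wall `|Y| + |Z| ≤ 51` (SUBFIELD.md §2; COMPUTATION-grade:
the cuspidal layer `(d, m) = (3, 152)` of the level-one frame module gives `9·(|Y| + |Z| − 1) ≤ 3·152`), one below the
LANDED relation-free Lean wall `subfieldCell_sixteen_wall` (`|Y| + |Z| ≤ 52`, `Negative/SubfieldCellSixteenCubes.lean`):
the maximum of `|Y| + |Z|` over the `q = 4` cell is now pinned to `{51, 52}` by theorems (`51` by computation); the
`q = 3` analogue is `(1,19)` (`subfieldCell_nine_witnessE`, `subfieldCell_nine_wall_attained`; there the sharp wall is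
landed too, `subfieldCell_nine_wall_twenty`).  The cell's records `(8,9)` (`subfieldCell_sixteen_witnessD`, volume 4320),
`(8,8)` (`…witnessC`) and the exponent-3 ceiling `Negative/SubfieldCellSixteenCubes.lean` (`60·|Y|·|Z| ≤ 40560`) are
untouched.
VALUE = CERTIFICATE / THEOREM, NOT summit progress.

CERTIFICATE FORMAT (new in gen 6: MOD-`p` EQUIVARIANT DUALS, `p = 3`).  Instead of megabytes of exact rational
separators (the Dixon certificate of gen 6's `(8,8)` design had ≈ 750-bit denominators), the files prove that the 0/1
evaluation system of the design — rows = the 3000 points `φ(SL₂ 𝔽₄)·(Y Y⁻¹ Z)` (50 cosets of `φ(SL₂ 𝔽₄)`: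
0 garbage + 50 target), columns = (line representative `u`, vector `v`) — has FULL ROW RANK modulo `3`:
for one representative `r_c` of every coset a frame table `b_c` over `ZMod 3` on the 17 line representatives
is exhibited whose evaluations on all 3000 points are `[g = r_c]` (the duals of the other points are the
`φ(SL₂ 𝔽₄)`-translates `b_c(u, h⁻¹v)`); `subfieldCell_pack_modp` (imported) turns this into rational frame
separators for every target (independence mod `p` ⇒ over `ℚ` ⇒ full row rank ⇒ solvable) and the clause.

DATA.  `k = 𝔽₄ = QuadraticAlgebra (ZMod 2) 1 1` (`x² = 1 + x`), `K = 𝔽₁₆ = QuadraticAlgebra 𝔽₄ x 1` (`y² = x + y`),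
elements `⟨⟨a, b⟩, ⟨c, d⟩⟩ = (a + b x) + (c + d x) y`, `code(e) = c₄(re) + 4 c₄(im)`, `c₄ = re + 2 im`;
`φ = Matrix.SpecialLinearGroup.mapGL K`; `SL₂(𝔽₄)` listed explicitly (60 matrices, identity first); `Y`, `Z` and
the coset representatives `r_c` (minimal code in their coset; garbage cosets first, then the targets' cosets in `Z`
order) are explicit units, each with its inverse (the 50 representatives as a `List` read with `getD`: a 50-term
`![…]` of units makes the `native_decide` code generator blow up — measured, > 400 s for 50 look-ups) —
here `Y = {1}` (ROW ONE: `W = Y Y⁻¹ ∖ {1} = ∅`, so a separated design is just a list of pairwise distinct target cosets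
`φ(SL₂ 𝔽₄)·z_l` in whose evaluation system every target point is a coloop; all 50 cosets of the point set are target
cosets, 0 garbage, and `z_l = r_l` is the minimal-code element of its coset) and `Z` = the representatives of 50 of the
1020 cosets of `φ(SL₂ 𝔽₄)` in `GL₂(𝔽₁₆)` found by gen 14's `rowone.py` (unit b2b-lgcu-subfield-g14: randomized greedy
over the cosets, seed 1 — a coset is accepted iff its 60 evaluation rows are independent mod 3 of the rows accepted
before; the first 50 random cosets all passed, i.e. wall-attaining row-one designs are generic at `q = 4`; mod 2 the
same greedy stalls at 24 cosets); certificate `rowone_q4_1x50_p3_s1.json` (sha256 `e205d8f45b1a02c2…`), archived with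
the search code under `run/shared/lean/b2b/levelgraded-cu/b2b-lgcu-subfield-g14/`.
Table `b_c(u_t, v) = (row_c[t] >>> (2·code₂ v)) mod 2^2` read in `ZMod 3`, `code₂ v = 16·code(v 0) + code(v 1)`,
`u_t = (1, x_t)` (`t = code x_t < 16`), `u_16 = (0, 1)`; 100143 non-zero entries in all.  The tables are
the mod-3 equivariant duals of that certificate: Gaussian elimination of the `3000 × 4352` evaluation matrix over `𝔽₃`
(full row rank 3000; 1.6·10⁶ row operations, 7 s of pure Python on the hub) and back-substitution for the 50 unit
right-hand sides at the representatives, every one of the `50 · 3000` identities re-verified in exact integer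
arithmetic before generation.

LEAN.  The five data objects (`SL₂(𝔽₄)` list, coset representatives, line representatives, `Y`, `Z`) are plain
`def`s in the first data file, so that every hypothesis statement and the assembly refer to the SAME constants
(re-stated literals make the elaborator's unifier blow up — measured); statements bind them by `let`.  The 50 dual identities (`50·3000`
evaluations of a 17-term table sum) are ONE `native_decide` PER BLOCK of cosets (axiom `Lean.ofReduceBool`; the tables are the explicit
witness; one DATA file `LevelGradedCohnUmansGradedDesignFamilyStubSubfieldCellSixteenDualsE<j>.lean` per block of cosets); exhaustiveness of the `SL₂(𝔽₄)` list, the coset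
cover (via explicit index tables) and target well-formedness are one `native_decide` each, injectivity (of `Y`: kernel `decide`; of the 50-term `Z` look-up: `native_decide`) and the
2·(1+50+50) inverse identities kernel `decide`; the assembly `subfieldCell_sixteen_witnessE` is a term-mode
application of the wrapper `subfieldCell_sixteen_packModPC` with CLOSED instance terms (no local instances:
`native_decide` refuses goals with free variables).
-/

namespace Summit.MatrixMultiplication.MatrixMultiplication.Theorems.GradedDesignFamily

open Matrix

set_option maxHeartbeats 20000000 in
set_option maxRecDepth 4000 in
set_option synthInstance.maxHeartbeats 2000000 in
set_option synthInstance.maxSize 1000000 in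
/-- The explicit list of `SL₂(𝔽₄)` (60 matrices) is exhaustive (`native_decide`). -/
theorem subfieldCell_sixteen_hslE :
    letI : Fintype (QuadraticAlgebra (ZMod 2) 1 1) := (Fintype.ofEquiv _ (QuadraticAlgebra.equivProd (1 : ZMod 2) 1).symm : Fintype (QuadraticAlgebra (ZMod 2) 1 1))
    let sl : Fin 60 → Matrix.SpecialLinearGroup (Fin 2) (QuadraticAlgebra (ZMod 2) 1 1) := subfieldCell_sixteen_slE
    ∀ a ∈ (Finset.univ : Finset (Matrix.SpecialLinearGroup (Fin 2) (QuadraticAlgebra (ZMod 2) 1 1))), ∃ n : Fin 60, sl n = a := by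
  native_decide

set_option maxHeartbeats 20000000 in
set_option maxRecDepth 4000 in
set_option synthInstance.maxHeartbeats 2000000 in
set_option synthInstance.maxSize 1000000 in
/-- Coset cover, tabulated: for every `(i, i', l)` the point `y_i y_i'⁻¹ z_l` equals
`φ(h_{N(i,i',l)}) · r_{C(i,i',l)}` for the explicit index tables `C`, `N` (50 identities, one `native_decide`). -/
theorem subfieldCell_sixteen_hcovE_table :
    let sl : Fin 60 → Matrix.SpecialLinearGroup (Fin 2) (QuadraticAlgebra (ZMod 2) 1 1) := subfieldCell_sixteen_slE
    let r : Fin 50 → GL (Fin 2) (QuadraticAlgebra (QuadraticAlgebra (ZMod 2) 1 1) ⟨0, 1⟩ 1) := subfieldCell_sixteen_repsE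
    let y : Fin 1 → GL (Fin 2) (QuadraticAlgebra (QuadraticAlgebra (ZMod 2) 1 1) ⟨0, 1⟩ 1) := subfieldCell_sixteen_yE
    let z : Fin 50 → GL (Fin 2) (QuadraticAlgebra (QuadraticAlgebra (ZMod 2) 1 1) ⟨0, 1⟩ 1) := subfieldCell_sixteen_zE
    let C : Fin 1 → Fin 1 → Fin 50 → Fin 50 :=
      (fun (i i' : Fin 1) (l : Fin 50) =>
        ([0, 1, 2, 3, 4, 5, 6, 7, 8, 9, 10, 11, 12, 13, 14, 15, 16, 17, 18, 19, 20, 21, 22, 23, 24, 25, 26, 27, 28, 29, 30, 31,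
          32, 33, 34, 35, 36, 37, 38, 39, 40, 41, 42, 43, 44, 45, 46, 47, 48, 49] : List (Fin 50)).getD ((1 * i.val + i'.val) * 50 + l.val) 0)
    let N : Fin 1 → Fin 1 → Fin 50 → Fin 60 :=
      (fun (i i' : Fin 1) (l : Fin 50) =>
        ([0, 0, 0, 0, 0, 0, 0, 0, 0, 0, 0, 0, 0, 0, 0, 0, 0, 0, 0, 0, 0, 0, 0, 0, 0, 0, 0, 0, 0, 0, 0, 0,
          0, 0, 0, 0, 0, 0, 0, 0, 0, 0, 0, 0, 0, 0, 0, 0, 0, 0] : List (Fin 60)).getD ((1 * i.val + i'.val) * 50 + l.val) 0)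
    ∀ i i' : Fin 1, ∀ l : Fin 50,
      Matrix.SpecialLinearGroup.mapGL (QuadraticAlgebra (QuadraticAlgebra (ZMod 2) 1 1) ⟨0, 1⟩ 1) (sl (N i i' l)) * r (C i i' l) = y i * (y i')⁻¹ * z l := by
  native_decide

set_option maxHeartbeats 20000000 in
set_option maxRecDepth 4000 in
set_option synthInstance.maxHeartbeats 2000000 in
set_option synthInstance.maxSize 1000000 in
/-- Coset cover (hypothesis `hcov` of the pack lemma): every point of `Y Y⁻¹ Z` lies in one of the 50 listed
cosets of `φ(SL₂ 𝔽₄)`. -/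
theorem subfieldCell_sixteen_hcovE :
    let sl : Fin 60 → Matrix.SpecialLinearGroup (Fin 2) (QuadraticAlgebra (ZMod 2) 1 1) := subfieldCell_sixteen_slE
    let r : Fin 50 → GL (Fin 2) (QuadraticAlgebra (QuadraticAlgebra (ZMod 2) 1 1) ⟨0, 1⟩ 1) := subfieldCell_sixteen_repsE
    let y : Fin 1 → GL (Fin 2) (QuadraticAlgebra (QuadraticAlgebra (ZMod 2) 1 1) ⟨0, 1⟩ 1) := subfieldCell_sixteen_yE
    let z : Fin 50 → GL (Fin 2) (QuadraticAlgebra (QuadraticAlgebra (ZMod 2) 1 1) ⟨0, 1⟩ 1) := subfieldCell_sixteen_zE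
    ∀ i i' : Fin 1, ∀ l : Fin 50, ∃ c : Fin 50, ∃ n' : Fin 60,
      Matrix.SpecialLinearGroup.mapGL (QuadraticAlgebra (QuadraticAlgebra (ZMod 2) 1 1) ⟨0, 1⟩ 1) (sl n') * r c = y i * (y i')⁻¹ * z l :=
  fun i i' l => ⟨_, _, subfieldCell_sixteen_hcovE_table i i' l⟩

set_option maxHeartbeats 20000000 in
set_option maxRecDepth 4000 in
set_option synthInstance.maxHeartbeats 2000000 in
set_option synthInstance.maxSize 1000000 in
/-- Target well-formedness (hypothesis `hwf`): `φ(h) y_i y_i'⁻¹ z_l = z_j` only trivially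
(150000 implications, one `native_decide`). -/
theorem subfieldCell_sixteen_hwfE :
    let sl : Fin 60 → Matrix.SpecialLinearGroup (Fin 2) (QuadraticAlgebra (ZMod 2) 1 1) := subfieldCell_sixteen_slE
    let y : Fin 1 → GL (Fin 2) (QuadraticAlgebra (QuadraticAlgebra (ZMod 2) 1 1) ⟨0, 1⟩ 1) := subfieldCell_sixteen_yE
    let z : Fin 50 → GL (Fin 2) (QuadraticAlgebra (QuadraticAlgebra (ZMod 2) 1 1) ⟨0, 1⟩ 1) := subfieldCell_sixteen_zE
    ∀ n : Fin 60, ∀ i i' : Fin 1, ∀ l j : Fin 50,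
      Matrix.SpecialLinearGroup.mapGL (QuadraticAlgebra (QuadraticAlgebra (ZMod 2) 1 1) ⟨0, 1⟩ 1) (sl n) * y i * (y i')⁻¹ * z l = z j →
      sl n = 1 ∧ y i = y i' ∧ z l = z j := by
  native_decide

set_option maxHeartbeats 20000000 in
set_option maxRecDepth 4000 in
set_option synthInstance.maxHeartbeats 2000000 in
set_option synthInstance.maxSize 1000000 in
/-- **TRUE instance of the subfield-cell clause at `|K| = 16` with `|Y| = 1`, `|Z| = 50`** (binder structure of
`stub_subfieldCell` with the asymptotic prefix replaced by the concrete cardinalities; mod-`3` dual certificate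
through `subfieldCell_pack_modp`; certificate, not summit progress). -/
theorem subfieldCell_sixteen_witnessE :
    ∃ (k K : Type) (_ : Field k) (_ : Fintype k) (_ : DecidableEq k)
      (_ : Field K) (_ : Fintype K) (_ : DecidableEq K)
      (φ : Matrix.SpecialLinearGroup (Fin 2) k →* Matrix.GeneralLinearGroup (Fin 2) K),
      Function.Injective φ ∧ Fintype.card K = Fintype.card k ^ 2 ∧ Fintype.card K = 16 ∧
      ∃ Y Z : Finset (Matrix.GeneralLinearGroup (Fin 2) K),
        Y.card = 1 ∧ Z.card = 50 ∧
        ∀ z₀ ∈ Z, ∃ cf : (Fin 2 → K) → (Fin 2 → K) → ℂ,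
          ∀ a : Matrix.SpecialLinearGroup (Fin 2) k, ∀ y ∈ Y, ∀ y' ∈ Y, ∀ z ∈ Z,
            (∑ u : Fin 2 → K, cf u (((φ a * y * y'⁻¹ * z : Matrix.GeneralLinearGroup (Fin 2) K) :
                Matrix (Fin 2) (Fin 2) K).mulVec u)) =
              if a = 1 ∧ y = y' ∧ z = z₀ then 1 else 0 :=
  subfieldCell_sixteen_packModPC
    (hF4 := ⟨by decide⟩)
    (hF16 := ⟨fun r => by obtain ⟨a, b⟩ := r; revert a b; decide⟩)
    (hK4 := (Fintype.ofEquiv _ (QuadraticAlgebra.equivProd (1 : ZMod 2) 1).symm : Fintype (QuadraticAlgebra (ZMod 2) 1 1)))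
    (hK16 := (@Fintype.ofEquiv (QuadraticAlgebra (QuadraticAlgebra (ZMod 2) 1 1) ⟨0, 1⟩ 1) ((QuadraticAlgebra (ZMod 2) 1 1) × (QuadraticAlgebra (ZMod 2) 1 1))
        (@instFintypeProd (QuadraticAlgebra (ZMod 2) 1 1) (QuadraticAlgebra (ZMod 2) 1 1)
          (Fintype.ofEquiv _ (QuadraticAlgebra.equivProd (1 : ZMod 2) 1).symm : Fintype (QuadraticAlgebra (ZMod 2) 1 1))
          (Fintype.ofEquiv _ (QuadraticAlgebra.equivProd (1 : ZMod 2) 1).symm : Fintype (QuadraticAlgebra (ZMod 2) 1 1)))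
        (QuadraticAlgebra.equivProd (⟨0, 1⟩ : QuadraticAlgebra (ZMod 2) 1 1) 1).symm))
    (h4 := rfl) (h16 := rfl) (p := 3) (hp := ⟨by norm_num⟩)
    subfieldCell_sixteen_yE subfieldCell_sixteen_zE subfieldCell_sixteen_slE subfieldCell_sixteen_repsE subfieldCell_sixteen_linesE
    (by decide) (by native_decide) subfieldCell_sixteen_hslE subfieldCell_sixteen_hcovE subfieldCell_sixteen_hwfE
    subfieldCell_sixteen_dualsE0 subfieldCell_sixteen_dualsE1 subfieldCell_sixteen_dualsE2 subfieldCell_sixteen_dualsE3 subfieldCell_sixteen_dualsE4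

end Summit.MatrixMultiplication.MatrixMultiplication.Theorems.GradedDesignFamily
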